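import Literature.AlgebraicGeometry.Resolution.StrictTransformOpenImmersion
import Literature.AlgebraicGeometry.Resolution.BlowupsScaling
import Literature.AlgebraicGeometry.Resolution.AffineBlowupUniversal
import Literature.AlgebraicGeometry.Resolution.ResolutionGlue
import HarnessLib

/-!
# Crux `FrobeniusLadder.FRationalResolution` (stmt-ResolutionOfSingularities-15317), line `redirect`,
# stub `stub_diagonalizableQuotientResolution` — a blow-up ABSORBS every centre it already makes Cartier: the blow-up of
# `K` is also the blow-up of `K · ∏ᵢ Lᵢ` whenever each `Lᵢ` pulls back to an effective Cartier divisor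

Regularity tool for the SYMMETRIZED PIECE of the Galois route (`…GaloisSymmetrizedPiece.exists_decomposition_stable_piece`:
`I = ∏_{σ ∈ D} (1 ⊗ σ)(I₁)` is decomposition-stable by construction, so the route's remaining obligation is that the blow-up
of this PRODUCT is regular). By the universal property of blowing up (Stacks 080A with the second blow-up trivial): if
`π : X' → X` is a blow-up along `K` and the ideals `Lᵢ` all pull back to effective Cartier divisors on `X'`, then `π` is a
blow-up along `K · ∏ᵢ Lᵢ` as well; hence the blow-up of the product is ISOMORPHIC to `X'` (uniqueness of blow-ups), in
particular regular when `X'` is. For the symmetrized piece: if the blow-up of the piece `I₁` already makes every twist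
`(1 ⊗ σ)(I₁)` Cartier (on the split toric side: the fan of the monomial centre is invariant under the permutations by
which the decomposition group acts), the blow-up of `I` is the blow-up of `I₁`, regular.

* `isBlowup_mul_prod_of_isEffectiveCartier_comap` — `IsBlowup π K`, all `Lᵢ·𝒪_{X'}` effective Cartier ⇒
  `IsBlowup π (K · ∏_{i ∈ s} Lᵢ)` (finite-product form of the tree's `IsBlowup.mul_of_isEffectiveCartier_comap`);
* `isBlowup_prod_of_isEffectiveCartier_comap` — with `K = L_{i₀}` one of the factors (`i₀ ∈ s`, idempotent product:
  `L_{i₀} · ∏ Lᵢ`-form avoided): `IsBlowup π (L i₀)` and all `Lᵢ·𝒪_{X'}` effective Cartier ⇒ `IsBlowup π (∏_{i ∈ s} Lᵢ)`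
  when `i₀ ∈ s` — stated as `IsBlowup π (L i₀ * ∏_{i ∈ s.erase i₀} L i)`;
* **`affineBlowup_prod_isRegular_of_isEffectiveCartier`** — affine form for ideals `J, Jᵢ ⊆ R`: if `Bl_J(Spec R)` is
  regular and every `J̃ᵢ` pulls back to an effective Cartier divisor on it, then `Bl_{J·∏ Jᵢ}(Spec R)` is regular;
  primed form `…'` with `J = J_{i₀}`, `i₀ ∈ s`, concluding for `Bl_{∏_{i ∈ s} Jᵢ}`.

Honest label: plumbing toward ONE leaf stub (no stub, crux or summit closed). No definitions, no named facts, no sorry.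
[cite: StacksProject, Tag 080A; Tag 0806]
-/

noncomputable section

-- single-problem summit: the doubled namespace component is forced
set_option linter.dupNamespace false

open CategoryTheory AlgebraicGeometry
open Literature.AlgebraicGeometry.Resolution

namespace Summit.ResolutionOfSingularities.ResolutionOfSingularities.Theorems.FRationalResolution.BlowupAbsorbsCartier

universe u

/-- **Finite-product form.** If `π` is a blow-up along `K` and every `Lᵢ·𝒪_{X'}` (`i ∈ s`) is an effective Cartier
divisor, then `π` is a blow-up along `K · ∏_{i ∈ s} Lᵢ`. [cite: StacksProject, Tag 080A] -/
theorem isBlowup_mul_prod_of_isEffectiveCartier_comap {X' X : Scheme.{u}} {π : X' ⟶ X} {K : X.IdealSheafData}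
    (hπ : IsBlowup π K) {ι : Type*} (s : Finset ι) (L : ι → X.IdealSheafData)
    (hL : ∀ i ∈ s, IsEffectiveCartier ((L i).comap π)) : IsBlowup π (K * ∏ i ∈ s, L i) := by
  classical
  induction s using Finset.induction_on with
  | empty => simpa using hπ
  | insert a s ha ih =>
    have ih' : IsBlowup π (K * ∏ i ∈ s, L i) := ih fun i hi => hL i (Finset.mem_insert_of_mem hi)
    rw [Finset.prod_insert ha, mul_left_comm, mul_comm]
    exact IsBlowup.mul_of_isEffectiveCartier_comap ih' (hL a (Finset.mem_insert_self a s))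

/-- **A blow-up along one factor that makes all factors Cartier is the blow-up of the product.** If `π` is a blow-up
along `L i₀`, `i₀ ∈ s`, and every `Lᵢ·𝒪_{X'}` (`i ∈ s`) is effective Cartier, then `π` is a blow-up along
`L i₀ · ∏_{i ∈ s ∖ i₀} Lᵢ` (`= ∏_{i ∈ s} Lᵢ`). [cite: StacksProject, Tag 080A] -/
theorem isBlowup_prod_of_isEffectiveCartier_comap {X' X : Scheme.{u}} {π : X' ⟶ X} {ι : Type*} [DecidableEq ι]
    (s : Finset ι)
    (L : ι → X.IdealSheafData) (i₀ : ι) (hπ : IsBlowup π (L i₀))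
    (hL : ∀ i ∈ s, IsEffectiveCartier ((L i).comap π)) :
    IsBlowup π (L i₀ * ∏ i ∈ s.erase i₀, L i) :=
  isBlowup_mul_prod_of_isEffectiveCartier_comap hπ (s.erase i₀) L fun i hi => hL i (Finset.mem_of_mem_erase hi)

/-- **Affine form: the blow-up of `J · ∏ Jᵢ` is regular as soon as `Bl_J(Spec R)` is regular and makes every `Jᵢ`
Cartier.** (`Bl_J(Spec R)` is then a blow-up along `(J · ∏ Jᵢ)~ = J̃ · ∏ J̃ᵢ`, hence isomorphic over `Spec R` to
`Bl_{J·∏ Jᵢ}(Spec R)` by uniqueness of blow-ups; regularity is invariant under isomorphism.)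
[cite: StacksProject, Tag 080A; Tag 0806] [cite: GortzWedhorn2020, Prop. 13.92] -/
theorem affineBlowup_prod_isRegular_of_isEffectiveCartier {R : Type u} [CommRing R] (J : Ideal R) {ι : Type*}
    (s : Finset ι) (Js : ι → Ideal R) (hreg : Scheme.IsRegular (affineBlowup J))
    (hcart : ∀ i ∈ s, IsEffectiveCartier ((affineBlowup.idealSheaf (Js i)).comap (affineBlowup.π J))) :
    Scheme.IsRegular (affineBlowup (J * ∏ i ∈ s, Js i)) := by
  classical
  -- `Bl_J` is a blow-up along `(J · ∏_{i ∈ t} Jᵢ)~` for every `t ⊆ s` (induction on `t`)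
  have h1 : ∀ t : Finset ι, (∀ i ∈ t, IsEffectiveCartier ((affineBlowup.idealSheaf (Js i)).comap (affineBlowup.π J))) →
      IsBlowup (affineBlowup.π J) (affineBlowup.idealSheaf (J * ∏ i ∈ t, Js i)) := by
    intro t
    induction t using Finset.induction_on with
    | empty =>
      intro _
      simpa using affineBlowup.isBlowup J
    | insert a t ha ih =>
      intro ht
      rw [Finset.prod_insert ha, mul_left_comm, mul_comm, affineBlowup.idealSheaf_mul]
      exact IsBlowup.mul_of_isEffectiveCartier_comap (ih fun i hi => ht i (Finset.mem_insert_of_mem hi))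
        (ht a (Finset.mem_insert_self a t))
  -- uniqueness of blow-ups: `Bl_J ≅ Bl_{J ∏ Jᵢ}` over `Spec R`, and regularity passes along the isomorphism
  obtain ⟨e, -, -⟩ := (h1 s hcart).unique (affineBlowup.isBlowup (J * ∏ i ∈ s, Js i))
  exact Scheme.IsRegular.of_iso e.hom hreg

/-- **Product form over one of the factors.** If `i₀ ∈ s`, `Bl_{J_{i₀}}(Spec R)` is regular and makes every `J̃ᵢ`
(`i ∈ s`) Cartier, then `Bl_{∏_{i ∈ s} Jᵢ}(Spec R)` is regular — the form consumed by the symmetrized piece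
`∏_{σ ∈ D} (1 ⊗ σ)(I₁)` (factor `σ = 1`). [cite: StacksProject, Tag 080A; Tag 0806] -/
theorem affineBlowup_prod_isRegular_of_isEffectiveCartier' {R : Type u} [CommRing R] {ι : Type*} [DecidableEq ι]
    (s : Finset ι) (Js : ι → Ideal R) {i₀ : ι} (hi₀ : i₀ ∈ s) (hreg : Scheme.IsRegular (affineBlowup (Js i₀)))
    (hcart : ∀ i ∈ s, IsEffectiveCartier ((affineBlowup.idealSheaf (Js i)).comap (affineBlowup.π (Js i₀)))) :
    Scheme.IsRegular (affineBlowup (∏ i ∈ s, Js i)) := by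
  rw [← Finset.mul_prod_erase s Js hi₀]
  exact affineBlowup_prod_isRegular_of_isEffectiveCartier (Js i₀) (s.erase i₀) Js hreg
    fun i hi => hcart i (Finset.mem_of_mem_erase hi)

end Summit.ResolutionOfSingularities.ResolutionOfSingularities.Theorems.FRationalResolution.BlowupAbsorbsCartier

end
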